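import Summits.QuantumFields.BalabanUV.Beta.FP.CoarseInverseScalarSteps
import Literature.MathematicalPhysics.QuantumFieldTheory.Balaban1983to89.Beta.DyadicShell

/-!
# Road FP (binder row D1), leaf H′2-IR ∕ IR-4b: THE COARSE INVERSE OF THE BLOCKED MASSLESS COVARIANCE IS pv23's SCALAR ACTION KERNEL —
# `C := N^{−(d+2)}·actionKer (N−1) 1` is a two-sided inverse of `M(v,w) = Σ_{p∈B(v)} Σ_{q∈B(w)} G₀(p−q)` on `ℤ^d`, and decays exponentially,
# `N`-UNIFORMLY: `|C u v| ≤ (cInv d 1 + 1)·N^{−(d+2)}·e^{−deltaInv d 1·dist u v}`  ((H-CINV) of row IR-4, as a theorem)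

HONEST DEPENDENCY (page 1, mandatory): continuum YM on T⁴ ⇐ BetaPertH ∧ nine spine estimates (0/9 proved); BetaPertH ⇐ (D1) ∧ (D4) ∧
CAP+tail; G-an2-4 gates asym, D1 and NE2/3/4.  HONEST FRAMING (cell contract, verbatim): «discharging `BetaPertH` makes Bałaban's UV
stability UNCONDITIONAL — a real constructive-QFT result; it is NOT the continuum limit and NOT the Clay problem.»  THIS MODULE is [folklore]
resolvent bookkeeping over pv23's WHOLE-LATTICE SCALAR COLUMN BY NAME (`B6QGQLower276`: blocks `B n y`, `chart`, the site matrix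
`AX n a = (n+1)²(−Δ) + a(n+1)^{−d}1[same block]`, `kerQGQ`; `B6QGQDecay237`: `cU`∕`deltaU`∕`cInv`∕`deltaInv`, `abs_kerQGQ_le_unif`;
`B5Hk103ScalarZd`: `Gk = G′`, `Kinv = (Q′G′Q′*)⁻¹`, `abs_Gk_le`, `abs_Kinv_le`, `tsum_Kinv_mul_kerQGQ`, `tsum_mul_tsum_comm`, `tsum_blocks`,
`summable_expX`; `B6QGQFourier275Zd`: `rowAX_eq`, `eq_tsum_Gk_mul_rowAX` (bounded solutions are represented by `G′`), `sum_B_eq`;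
`B5Hk165ActionZd`: `actionKer = Kinv − aδ`; `B5Hk165PolarZd`: `actionKer_symm`) and lit1's free Green function
(`neg_latticeLaplacianZd_half_latticeGreen_sub`, `latticeGreen_le_latticeGreen_zero`, `latticeGreen_nonneg`, `latticeGreen_neg`); no `def`,
no `def … : Prop`, nothing cited, 0 sorry.  ROUTE OF RECORD per the owner's R-FP-21 (A3) (journal l.21280): NO new analysis — the decay
is pv23's mesh-free Combes–Thomas (`qGqInv_decay_unif`), the identity is the resolvent identity below.  It DISCHARGES the displayed hypothesis
(H-CINV) of leaf-05-g9's IR-4a (`hC`, `hCM`) and hence, with IR-4-IF ∕ IR-4a, the letters (T0)–(T2) of the ghost remainder; it does NOT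
touch `hasym` ∕ D1.  0∕4 binders of row D1; NOT D1, NOT BetaPertH, NOT continuum, NOT Clay.

ABSOLUTE RULE (cell charter, verbatim): «No internally-minted statement may enter as a cited fact. Every hypothesis is either kernel-proved
in this package or a verbatim quotation of a PUBLISHED theorem with page reference. The manuscript(s) under audit are NOT citable for their
own disputed steps — they are the thing under adjudication; programme-internal (2001/route/tribunal) claims are never citable.»

THE IDENTITY (block side `N = n+1`, `G₀ = latticeGreen∕2`, `−ΔG₀ = δ`, `d ≥ 3`; `G′ := Gk n 1 = ((n+1)²(−Δ) + (n+1)^{−d}Q′ᵀQ′)⁻¹`,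
`K := kerQGQ n 1 = (n+1)^{−d}·[block sums of G′]`, `Kinv := K⁻¹`, `M(y,y′) := Σ_{p∈B(y)}Σ_{q∈B(y′)} G₀(p−q)`).
(1) `φ_q := (n+1)⁻²G₀(·−q)` is BOUNDED and `AX·φ_q = δ_q + (n+1)^{−(d+2)}·S(blk ·, q)`, `S(u,q) := Σ_{r∈B(u)} G₀(r−q)` (`rowAX_eq` + `−ΔG₀ = δ`);
(2) `eq_tsum_Gk_mul_rowAX`: `(n+1)⁻²G₀(p−q) = G′(p,q) + (n+1)^{−(d+2)}·Σ′_z G′(p,z)·S(blk z, q)`;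
(3) block-summing over `p ∈ B(y)`, `q ∈ B(y′)` and regrouping `z` by blocks (`tsum_blocks`):
    `(n+1)⁻²·M(y,y′) = (n+1)^d·K(y,y′) + (n+1)⁻²·Σ′_u K(y,u)·M(u,y′)`;
(4) left-multiplying by `Kinv` (`tsum_Kinv_mul_kerQGQ`, Fubini `tsum_mul_tsum_comm` under the exp × exp × bounded majorant):
    `Σ′_y Kinv(x,y)·M(y,y′) = (n+1)^{d+2}·[x = y′] + M(x,y′)`, i.e. **`Σ′_y actionKer n 1 x y · M(y,y′) = (n+1)^{d+2}·[x = y′]`**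
    (`actionKer = Kinv − 1·δ` — «(Q′G₀Q′ᵀ)⁻¹ = (Q′G(a)Q′ᵀ)⁻¹ − a» with the zero mode already handled by pv23);
(5) mirror by the symmetry of `M` (`G₀` even) and of `actionKer`; (6) the an2-currency bracket of `ConstrainedGhost.coarse_woodbury`
    (`Σ_{b∈box} blockSum N (G₀(N•v + b − ·)) w`) IS `M(v,w)` (`sum_B_eq_blockSum`).
CONTENT (steps (1)–(3) are the helper file `FP/CoarseInverseScalarSteps`; split only for the 400-line rule). §5 step (4) = (C2) `tsum_actionKer_mul_M` ∕
`tsum_coarseInv_mul_M`, the decay (C1) `abs_coarseInv_le`, the mirror (C3) `tsum_M_mul_coarseInv`; §6 leaf-05-g9's (H-CINV) in its own spelling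
(`HasSum` against the `coarse_woodbury` bracket; `n+1` and `[NeZero N]` forms; `dist = supNorm` on `ℤ⁴`).
Unit `b2b-balaban-beta-d1-formalise-leaf-06` (gen 7), 2026-08-20; `LEAVES-FP.md` row IR-4b (owner R-FP-21 (A3) l.21280, INTENT l.≈21536).
-/

namespace Summit.QuantumFields.BalabanUV.Beta.FP.CoarseInverseScalar

open Finset
open scoped BigOperators
open Literature.Probability.LatticeModels (latticeGreen latticeLaplacianZd neg_latticeLaplacianZd_half_latticeGreen_sub
  latticeGreen_le_latticeGreen_zero latticeGreen_nonneg latticeGreen_neg)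
open Literature.MathematicalPhysics.QuantumFieldTheory.Balaban1983to89
open B6QGQLower276 (X e B blk chart side AX kerQGQ mem_B chart_mem_B sum_B_const)
open B6QGQDecay237 (cU deltaU cInv deltaInv cU_pos deltaU_pos cInv_pos deltaInv_pos abs_kerQGQ_le_unif)
open B5Hk103ScalarZd (Gk Kinv abs_Gk_le abs_Kinv_le tsum_Kinv_mul_kerQGQ tsum_mul_tsum_comm tsum_blocks summable_expX)
open B6QGQFourier275Zd (rowAX rowAX_eq eq_tsum_Gk_mul_rowAX sum_B_eq)
open B5Hk165ActionZd (actionKer)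
open B5Hk165PolarZd (actionKer_symm)
open Literature.MathematicalPhysics.QuantumFieldTheory.Balaban1983to89.Beta.AffineAveraging (blockSum toSite)

noncomputable section

variable {d : ℕ}

open CoarseInverseScalarSteps
/-! ## §5 Step (4): the resolvent identity `Σ′_y actionKer n 1 x y · M(y,y′) = (n+1)^{d+2}·[x = y′]`, the decay, the mirror -/

/-- [folklore] summability of `y ↦ Kinv(x,y)·f y` for bounded `f`. -/
theorem summable_Kinv_mul_bdd (n : ℕ) (x : X d) {f : X d → ℝ} {C : ℝ} (hf : ∀ y, |f y| ≤ C) :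
    Summable fun y => Kinv n 1 x y * f y := by
  refine Summable.of_norm_bounded ((summable_expX (deltaInv_pos d one_pos) x).mul_left (cInv d 1 * C)) fun y => ?_
  rw [Real.norm_eq_abs, abs_mul]
  have hC : 0 ≤ C := (abs_nonneg _).trans (hf y)
  calc |Kinv n 1 x y| * |f y| ≤ (cInv d 1 * Real.exp (-(deltaInv d 1 * dist x y))) * C :=
        mul_le_mul (abs_Kinv_le n one_pos x y) (hf y) (abs_nonneg _) (by have := (cInv_pos d one_pos).le; positivity)
    _ = cInv d 1 * C * Real.exp (-(deltaInv d 1 * dist x y)) := by ring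

/-- [folklore] `|Q′G′Q′*(y,y′)| ≤ c_u` (the mesh-free decay bound at distance `0`). -/
theorem abs_kerQGQ_le_cU (n : ℕ) {a : ℝ} (ha : 0 < a) (y y' : X d) : |kerQGQ n a y y'| ≤ cU d a := by
  refine (abs_kerQGQ_le_unif n ha y y').trans ?_
  have h1 : Real.exp (-(deltaU d a * dist y y')) ≤ 1 :=
    Real.exp_le_one_iff.mpr (by have := (deltaU_pos d ha).le; nlinarith [@dist_nonneg _ _ y y'])
  have := (cU_pos d ha).le
  nlinarith

/-- [folklore] STEP (4a): **`Σ′_y Kinv(x,y)·M(y,y′) = (n+1)^{d+2}·[x = y′] + M(x,y′)`**. -/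
theorem tsum_Kinv_mul_M (hd : 3 ≤ d) (n : ℕ) (x y' : X d) :
    ∑' y, Kinv n 1 x y * ∑ p ∈ B n y, ∑ q ∈ B n y', latticeGreen (p - q) / 2
      = ((n : ℝ) + 1) ^ (d + 2) * (if x = y' then 1 else 0) + ∑ p ∈ B n x, ∑ q ∈ B n y', latticeGreen (p - q) / 2 := by
  have hN : (0 : ℝ) < (n : ℝ) + 1 := by positivity
  set Mb : ℝ := ((n : ℝ) + 1) ^ d * (((n : ℝ) + 1) ^ d * (latticeGreen (0 : X d) / 2)) with hMb
  have hM : ∀ u, |∑ p ∈ B n u, ∑ q ∈ B n y', latticeGreen (p - q) / 2| ≤ Mb := fun u => abs_M_le hd n u y'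
  -- rewrite `M(y,y′)` through step (3), multiplied by `(n+1)²`
  have hstep : ∀ y : X d, ∑ p ∈ B n y, ∑ q ∈ B n y', latticeGreen (p - q) / 2
      = ((n : ℝ) + 1) ^ (d + 2) * kerQGQ n 1 y y' + ∑' u, kerQGQ n 1 y u * ∑ p ∈ B n u, ∑ q ∈ B n y', latticeGreen (p - q) / 2 := by
    intro y
    have h := M_div_eq hd n y y'
    rw [div_eq_iff (by positivity)] at h
    rw [h, add_mul, pow_add]
    field_simp
  rw [tsum_congr (fun y => by rw [hstep y])]
  simp_rw [mul_add]
  -- the majorant for Fubini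
  have hmaj : ∀ y u : X d, |Kinv n 1 x y * (kerQGQ n 1 y u * ∑ p ∈ B n u, ∑ q ∈ B n y', latticeGreen (p - q) / 2)|
      ≤ cInv d 1 * cU d 1 * Mb * Real.exp (-(deltaInv d 1 * dist x y)) * Real.exp (-(deltaU d 1 * dist y u)) := by
    intro y u
    rw [abs_mul, abs_mul]
    have h1 := abs_Kinv_le n one_pos x y
    have h2 := abs_kerQGQ_le_unif n one_pos y u
    have h3 := hM u
    have := (cInv_pos d one_pos).le
    have := (cU_pos d one_pos).le
    have hMb0 : 0 ≤ Mb := (abs_nonneg _).trans (hM x)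
    calc |Kinv n 1 x y| * (|kerQGQ n 1 y u| * |∑ p ∈ B n u, ∑ q ∈ B n y', latticeGreen (p - q) / 2|)
        ≤ (cInv d 1 * Real.exp (-(deltaInv d 1 * dist x y))) * ((cU d 1 * Real.exp (-(deltaU d 1 * dist y u))) * Mb) :=
          mul_le_mul h1 (mul_le_mul h2 h3 (abs_nonneg _) (by positivity)) (by positivity) (by positivity)
      _ = cInv d 1 * cU d 1 * Mb * Real.exp (-(deltaInv d 1 * dist x y)) * Real.exp (-(deltaU d 1 * dist y u)) := by ring
  have hunc := B5Hk103ScalarZd.summable_uncurry_of_majorant (deltaInv_pos d one_pos) (deltaU_pos d one_pos) x hmaj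
  have hsA : Summable fun y : X d => Kinv n 1 x y * (((n : ℝ) + 1) ^ (d + 2) * kerQGQ n 1 y y') := by
    have := (summable_Kinv_mul_bdd n x (fun y => abs_kerQGQ_le_cU n one_pos y y')).mul_left (((n : ℝ) + 1) ^ (d + 2))
    refine this.congr fun y => by ring
  have hsB : Summable fun y : X d => Kinv n 1 x y * ∑' u, kerQGQ n 1 y u * ∑ p ∈ B n u, ∑ q ∈ B n y', latticeGreen (p - q) / 2 := by
    refine hunc.prod.congr fun y => ?_
    show ∑' u, Kinv n 1 x y * (kerQGQ n 1 y u * ∑ p ∈ B n u, ∑ q ∈ B n y', latticeGreen (p - q) / 2) = _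
    rw [tsum_mul_left]
  rw [hsA.tsum_add hsB]
  congr 1
  · -- `(n+1)^{d+2} Σ′ Kinv·K = (n+1)^{d+2}·δ`
    have e : ∀ y : X d, Kinv n 1 x y * (((n : ℝ) + 1) ^ (d + 2) * kerQGQ n 1 y y')
        = ((n : ℝ) + 1) ^ (d + 2) * (Kinv n 1 x y * kerQGQ n 1 y y') := fun y => by ring
    simp_rw [e]
    rw [tsum_mul_left, tsum_Kinv_mul_kerQGQ n one_pos x y']
  · -- Fubini, `Σ′ Kinv·K = δ`, collapse
    rw [tsum_mul_tsum_comm (deltaInv_pos d one_pos) (deltaU_pos d one_pos) x hmaj]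
    have e : ∀ u : X d, ∑' y, Kinv n 1 x y * (kerQGQ n 1 y u * ∑ p ∈ B n u, ∑ q ∈ B n y', latticeGreen (p - q) / 2)
        = (if x = u then 1 else 0) * ∑ p ∈ B n u, ∑ q ∈ B n y', latticeGreen (p - q) / 2 := by
      intro u
      simp_rw [← mul_assoc]
      rw [tsum_mul_right, tsum_Kinv_mul_kerQGQ n one_pos x u]
    simp_rw [e]
    rw [tsum_eq_single x (fun u hu => by rw [if_neg (Ne.symm hu), zero_mul])]
    simp

/-- **(C2) THE RESOLVENT IDENTITY**: `Σ′_y actionKer n 1 x y · M(y,y′) = (n+1)^{d+2}·[x = y′]` — the scalar coarse ACTION kernel of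
pv23's column (`= (Q′G′Q′*)⁻¹ − δ`, `a = 1`) is `(n+1)^{d+2}` times a LEFT INVERSE of the blocked massless covariance `M`. [folklore] -/
theorem tsum_actionKer_mul_M (hd : 3 ≤ d) (n : ℕ) (x y' : X d) :
    ∑' y, actionKer n 1 x y * ∑ p ∈ B n y, ∑ q ∈ B n y', latticeGreen (p - q) / 2
      = ((n : ℝ) + 1) ^ (d + 2) * (if x = y' then 1 else 0) := by
  have hM : ∀ u, |∑ p ∈ B n u, ∑ q ∈ B n y', latticeGreen (p - q) / 2| ≤ _ := fun u => abs_M_le hd n u y'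
  have hs1 : Summable fun y : X d => Kinv n 1 x y * ∑ p ∈ B n y, ∑ q ∈ B n y', latticeGreen (p - q) / 2 :=
    summable_Kinv_mul_bdd n x hM
  have hs2 : Summable fun y : X d => (1 * if x = y then (1 : ℝ) else 0) * ∑ p ∈ B n y, ∑ q ∈ B n y', latticeGreen (p - q) / 2 :=
    summable_of_ne_finset_zero (s := {x}) (fun y hy => by
      rw [Finset.mem_singleton] at hy
      rw [if_neg (Ne.symm hy)]; ring)
  simp only [actionKer, sub_mul]
  rw [hs1.tsum_sub hs2, tsum_Kinv_mul_M hd n x y',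
    tsum_eq_single x (fun y hy => by rw [if_neg (Ne.symm hy)]; ring)]
  simp

/-- **(C2), NORMALISED**: with `coarseInv := (n+1)^{−(d+2)}·actionKer n 1`, `Σ′_y coarseInv(x,y)·M(y,y′) = [x = y′]`. [folklore] -/
theorem tsum_coarseInv_mul_M (hd : 3 ≤ d) (n : ℕ) (x y' : X d) :
    ∑' y, ((((n : ℝ) + 1) ^ (d + 2))⁻¹ * actionKer n 1 x y) * ∑ p ∈ B n y, ∑ q ∈ B n y', latticeGreen (p - q) / 2
      = if x = y' then 1 else 0 := by
  have hN : (0 : ℝ) < ((n : ℝ) + 1) ^ (d + 2) := by positivity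
  simp_rw [mul_assoc]
  rw [tsum_mul_left, tsum_actionKer_mul_M hd n x y', ← mul_assoc, inv_mul_cancel₀ hN.ne', one_mul]

/-- [folklore] summability behind (C2). -/
theorem summable_coarseInv_mul_M (hd : 3 ≤ d) (n : ℕ) (x y' : X d) :
    Summable fun y => ((((n : ℝ) + 1) ^ (d + 2))⁻¹ * actionKer n 1 x y) * ∑ p ∈ B n y, ∑ q ∈ B n y', latticeGreen (p - q) / 2 := by
  have hM : ∀ u, |∑ p ∈ B n u, ∑ q ∈ B n y', latticeGreen (p - q) / 2| ≤ _ := fun u => abs_M_le hd n u y'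
  have hs1 : Summable fun y : X d => Kinv n 1 x y * ∑ p ∈ B n y, ∑ q ∈ B n y', latticeGreen (p - q) / 2 :=
    summable_Kinv_mul_bdd n x hM
  have hs2 : Summable fun y : X d => (1 * if x = y then (1 : ℝ) else 0) * ∑ p ∈ B n y, ∑ q ∈ B n y', latticeGreen (p - q) / 2 :=
    summable_of_ne_finset_zero (s := {x}) (fun y hy => by
      rw [Finset.mem_singleton] at hy
      rw [if_neg (Ne.symm hy)]; ring)
  have := (hs1.sub hs2).mul_left ((((n : ℝ) + 1) ^ (d + 2))⁻¹)
  refine this.congr fun y => ?_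
  simp only [actionKer]
  ring

/-- **(C1) THE `n`-UNIFORM EXPONENTIAL DECAY OF THE COARSE INVERSE**: `|coarseInv(x,y)| ≤ (cInv d 1 + 1)·(n+1)^{−(d+2)}·e^{−deltaInv d 1·dist x y}`
(pv23's mesh-free `abs_Kinv_le` + the `δ` term; `dist` = the sup metric of `ℤ^d`). [folklore] -/
theorem abs_coarseInv_le (n : ℕ) (x y : X d) :
    |(((n : ℝ) + 1) ^ (d + 2))⁻¹ * actionKer n 1 x y|
      ≤ (cInv d 1 + 1) * (((n : ℝ) + 1) ^ (d + 2))⁻¹ * Real.exp (-(deltaInv d 1 * dist x y)) := by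
  have hN : (0 : ℝ) < (((n : ℝ) + 1) ^ (d + 2))⁻¹ := by positivity
  rw [abs_mul, abs_of_pos hN]
  have hK := abs_Kinv_le n one_pos x y
  have hc := (cInv_pos d one_pos).le
  have hA : |actionKer n 1 x y| ≤ (cInv d 1 + 1) * Real.exp (-(deltaInv d 1 * dist x y)) := by
    unfold actionKer
    by_cases hxy : x = y
    · subst hxy
      simp only [if_true, dist_self, mul_zero, neg_zero, Real.exp_zero, mul_one] at hK ⊢
      calc |Kinv n 1 x x - 1| ≤ |Kinv n 1 x x| + |(1 : ℝ)| := abs_sub _ _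
        _ ≤ cInv d 1 + 1 := by rw [abs_one]; linarith
    · rw [if_neg hxy, mul_zero, sub_zero]
      refine hK.trans ?_
      have := Real.exp_pos (-(deltaInv d 1 * dist x y))
      nlinarith
  calc (((n : ℝ) + 1) ^ (d + 2))⁻¹ * |actionKer n 1 x y|
      ≤ (((n : ℝ) + 1) ^ (d + 2))⁻¹ * ((cInv d 1 + 1) * Real.exp (-(deltaInv d 1 * dist x y))) := mul_le_mul_of_nonneg_left hA hN.le
    _ = (cInv d 1 + 1) * (((n : ℝ) + 1) ^ (d + 2))⁻¹ * Real.exp (-(deltaInv d 1 * dist x y)) := by ring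

/-- **(C3) THE MIRROR**: `Σ′_y M(w,y)·coarseInv(y,u) = [w = u]` (symmetry of `M` and of the action kernel). [folklore] -/
theorem tsum_M_mul_coarseInv (hd : 3 ≤ d) (n : ℕ) (w u : X d) :
    ∑' y, (∑ p ∈ B n w, ∑ q ∈ B n y, latticeGreen (p - q) / 2) * ((((n : ℝ) + 1) ^ (d + 2))⁻¹ * actionKer n 1 y u)
      = if w = u then 1 else 0 := by
  have e : ∀ y : X d, (∑ p ∈ B n w, ∑ q ∈ B n y, latticeGreen (p - q) / 2) * ((((n : ℝ) + 1) ^ (d + 2))⁻¹ * actionKer n 1 y u)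
      = ((((n : ℝ) + 1) ^ (d + 2))⁻¹ * actionKer n 1 u y) * ∑ p ∈ B n y, ∑ q ∈ B n w, latticeGreen (p - q) / 2 := by
    intro y
    rw [M_symm n w y, actionKer_symm n one_pos y u, mul_comm]
  simp_rw [e]
  rw [tsum_coarseInv_mul_M hd n u w]
  by_cases h : w = u
  · subst h; simp
  · rw [if_neg h, if_neg (Ne.symm h)]

/-! ## §6 (H-CINV) in leaf-05-g9's spelling -/

/-- **(H-CINV), LEFT IDENTITY, AGAINST THE `coarse_woodbury` BRACKET** (`N = n+1`): for every `u w`,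
`HasSum (v ↦ coarseInv(u,v) · Σ_{b∈box} blockSum (n+1) (G₀((n+1)•v + b − ·)) w) [u = w]`. [folklore] -/
theorem hasSum_coarseInv_mul_bracket (hd : 3 ≤ d) (n : ℕ) (u w : X d) :
    HasSum (fun v => ((((n : ℝ) + 1) ^ (d + 2))⁻¹ * actionKer n 1 u v)
      * ∑ b ∈ Literature.MathematicalPhysics.QuantumFieldTheory.Balaban1983to89.Beta.AffineAveraging.box d (n + 1),
          blockSum (n + 1) (fun z => latticeGreen ((((n + 1 : ℕ) : ℤ)) • v + toSite b - z) / 2) w)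
      (if u = w then 1 else 0) := by
  simp_rw [bracket_eq_M]
  rw [← tsum_coarseInv_mul_M hd n u w]
  exact (summable_coarseInv_mul_M hd n u w).hasSum

/-- **(H-CINV), RIGHT IDENTITY (mirror)**: `HasSum (v ↦ (Σ_{b∈box} blockSum (n+1) (G₀((n+1)•w + b − ·)) v) · coarseInv(v,u)) [w = u]`. [folklore] -/
theorem hasSum_bracket_mul_coarseInv (hd : 3 ≤ d) (n : ℕ) (w u : X d) :
    HasSum (fun v => (∑ b ∈ Literature.MathematicalPhysics.QuantumFieldTheory.Balaban1983to89.Beta.AffineAveraging.box d (n + 1),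
          blockSum (n + 1) (fun z => latticeGreen ((((n + 1 : ℕ) : ℤ)) • w + toSite b - z) / 2) v)
        * ((((n : ℝ) + 1) ^ (d + 2))⁻¹ * actionKer n 1 v u))
      (if w = u then 1 else 0) := by
  simp_rw [bracket_eq_M]
  have hs : Summable fun v : X d => (∑ p ∈ B n w, ∑ q ∈ B n v, latticeGreen (p - q) / 2) * ((((n : ℝ) + 1) ^ (d + 2))⁻¹ * actionKer n 1 v u) := by
    refine (summable_coarseInv_mul_M hd n u w).congr fun v => ?_
    rw [M_symm n w v, actionKer_symm n one_pos v u, mul_comm]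
  rw [← tsum_M_mul_coarseInv hd n w u]
  exact hs.hasSum

/-- **(H-CINV) FOR A BLOCK SIDE `N ≥ 1` WRITTEN AS `N`** (`coarseInv N := N^{−(d+2)}·actionKer (N−1) 1`): the left identity. [folklore] -/
theorem hasSum_coarseInv_mul_bracket' (hd : 3 ≤ d) (N : ℕ) [NeZero N] (u w : X d) :
    HasSum (fun v => ((((N : ℝ)) ^ (d + 2))⁻¹ * actionKer (N - 1) 1 u v)
      * ∑ b ∈ Literature.MathematicalPhysics.QuantumFieldTheory.Balaban1983to89.Beta.AffineAveraging.box d N,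
          blockSum N (fun z => latticeGreen (((N : ℤ)) • v + toSite b - z) / 2) w)
      (if u = w then 1 else 0) := by
  obtain ⟨n, rfl⟩ := Nat.exists_eq_succ_of_ne_zero (NeZero.ne N)
  have h := hasSum_coarseInv_mul_bracket hd n u w
  simp only [Nat.succ_sub_one, Nat.cast_succ] at h ⊢
  exact h

/-- **(C1) FOR `N`**: `|coarseInv N u v| ≤ (cInv d 1 + 1)·N^{−(d+2)}·e^{−deltaInv d 1·dist u v}`, `N ≥ 1`, the constants `N`-FREE. [folklore] -/
theorem abs_coarseInv_le' (N : ℕ) [NeZero N] (u v : X d) :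
    |((((N : ℝ)) ^ (d + 2))⁻¹ * actionKer (N - 1) 1 u v)|
      ≤ (cInv d 1 + 1) * (((N : ℝ)) ^ (d + 2))⁻¹ * Real.exp (-(deltaInv d 1 * dist u v)) := by
  obtain ⟨n, rfl⟩ := Nat.exists_eq_succ_of_ne_zero (NeZero.ne N)
  have h := abs_coarseInv_le (d := d) n u v
  simp only [Nat.succ_sub_one, Nat.cast_succ] at h ⊢
  exact h

/-- [folklore] ON `ℤ⁴`, THE METRIC OF pv23's COLUMN IS THE SUP NORM OF `DyadicShell`: `dist u v = ‖u − v‖_∞`. -/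
theorem dist_eq_supNorm (u v : Literature.MathematicalPhysics.QuantumFieldTheory.Balaban1983to89.Beta.DyadicShell.Pt) :
    dist u v = (Literature.MathematicalPhysics.QuantumFieldTheory.Balaban1983to89.Beta.DyadicShell.supNorm (u - v) : ℝ) := by
  have hcoord : ∀ i : Fin 4, dist (u i) (v i) = (((u - v) i).natAbs : ℝ) := by
    intro i
    rw [Int.dist_eq, Nat.cast_natAbs, Int.cast_abs, Pi.sub_apply, Int.cast_sub]
  apply le_antisymm
  · refine (dist_pi_le_iff (by positivity)).2 fun i => ?_
    rw [hcoord]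
    exact_mod_cast Literature.MathematicalPhysics.QuantumFieldTheory.Balaban1983to89.Beta.DyadicShell.natAbs_le_supNorm (u - v) i
  · obtain ⟨i, hi⟩ := Literature.MathematicalPhysics.QuantumFieldTheory.Balaban1983to89.Beta.DyadicShell.exists_eq_supNorm (u - v)
    rw [← hi, ← hcoord i]
    exact dist_le_pi_dist u v i

/-- **(C1) IN leaf-05-g9's LETTER SHAPE** (`d = 4`, sup norm): `|coarseInv (n+1) u v| ≤ (cInv 4 1 + 1)·(n+1)⁻⁶·e^{−deltaInv 4 1·‖u − v‖_∞}`. [folklore] -/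
theorem abs_coarseInv_le_supNorm (n : ℕ) (u v : Literature.MathematicalPhysics.QuantumFieldTheory.Balaban1983to89.Beta.DyadicShell.Pt) :
    |((((n : ℝ) + 1) ^ (4 + 2))⁻¹ * actionKer n 1 u v)|
      ≤ (cInv 4 1 + 1) * (((n : ℝ) + 1) ^ (4 + 2))⁻¹
        * Real.exp (-(deltaInv 4 1 * (Literature.MathematicalPhysics.QuantumFieldTheory.Balaban1983to89.Beta.DyadicShell.supNorm (u - v) : ℝ))) := by
  have h := abs_coarseInv_le (d := 4) n u v
  rwa [dist_eq_supNorm] at h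

end

end Summit.QuantumFields.BalabanUV.Beta.FP.CoarseInverseScalar
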